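import Literature.MathematicalPhysics.QuantumFieldTheory.TiltedExponentMorseBounds
import HarnessLib

/-!
# The one-link trace shift `Re tr(Wᴴ U) − Re tr U` against the small-field variables `N − Re tr` (Hilbert–Schmidt geometry of `U(N)`)

Source of the identity used: S. Chatterjee, *Rigorous solution of strongly coupled SO(N) lattice gauge theory in the large
N limit*, arXiv:1602.01222, §7, **Lemma 7.2**: "`Re tr(1 − U) = ½‖1 − U‖²` for unitary `U`" [in the tree as
`UnitaryCayley.re_trace_one_sub` / `OneLinkLaplace.re_trace_conjTranspose_mul_sub_of_mem_unitaryGroup` (the sphere identity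
`Re tr(Bᴴ(B − A)) = ½‖A − B‖²_F`)], together with the Cauchy–Schwarz inequality for the Hilbert–Schmidt pairing
`|Re tr(Aᴴ B)| ≤ ‖A‖_F ‖B‖_F` (`OneLinkLaplace.abs_re_trace_conjTranspose_mul_le`).

What is here (everything PROVED; no definitions, no named facts).  For unitary `U, W ∈ U(N)` write `u(X) := N − Re tr X`
(`= ½‖1 − X‖²_F ≥ 0`, the one-link small-field variable of lattice gauge theory).  Then the shift of the one-link trace under
left multiplication by `Wᴴ = W⁻¹`,
`Δ(W, U) := Re tr(Wᴴ U) − Re tr U = Re⟨W − 1, U − 1⟩_HS − u(W)`                         (`re_trace_conjTranspose_mul_sub_eq`)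
obeys
* `|Δ| ≤ 2 √(u(W) u(U)) + u(W)`                                                          (`abs_traceShift_le`),
* `Δ² ≤ 2 u(W)² + 8 u(W) u(U)`                                                           (`sq_traceShift_le`),
* and, since `Δ(W, −U) = −Δ(W, U)`, the same with `u(−U) = N + Re tr U` in place of `u(U)`  (`sq_traceShift_le_neg`), hence with
  `min (N − Re tr U) (N + Re tr U)` — for `N = 2`: `2 − |Re tr U|`                           (`sq_traceShift_le_min`).
These are the «one-link trigonometry» bounds used to control the Lipschitz deficit of class-angle trial functions under the
Wilson link factor `exp(B Re tr(U V⁻¹))` (cell `ym-beyond`, crux ONE of `route-QuantumFields-LuscherReduction`,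
`RUNG-W1up-PLAN` Step C3, there derived by quaternion algebra for `SU(2)`; here for every `N` by Hilbert–Schmidt geometry).
Versions for the group-subtype `Matrix.specialUnitaryGroup (Fin N) ℂ` with `W⁻¹ * U` are given at the end.
-/

noncomputable section

open scoped Matrix

namespace Literature.MathematicalPhysics.QuantumFieldTheory.OneLinkTraceShift

open Literature.MathematicalPhysics.QuantumFieldTheory (frobNorm frobNorm_nonneg frobNorm_sq_eq_re_trace
  frobNorm_sq_of_mem_unitaryGroup)
open Literature.MathematicalPhysics.QuantumFieldTheory.OneLinkLaplace (abs_re_trace_conjTranspose_mul_le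
  re_trace_conjTranspose_mul_sub_of_mem_unitaryGroup frobNorm_sub_sq re_trace_conjTranspose_mul_comm)

variable {N : ℕ} {X W U : Matrix (Fin N) (Fin N) ℂ}

/-- `u(X) = N − Re tr X = ½ ‖X − 1‖²_F` for unitary `X` (Chatterjee's Lemma 7.2, through the tree's sphere identity with `B = 1`).
[cite: arXiv160201222, Lemma 7.2] -/
theorem card_sub_re_trace_eq (hX : X ∈ Matrix.unitaryGroup (Fin N) ℂ) :
    (N : ℝ) - X.trace.re = frobNorm (X - 1) ^ 2 / 2 := by
  have h := re_trace_conjTranspose_mul_sub_of_mem_unitaryGroup hX (Submonoid.one_mem (Matrix.unitaryGroup (Fin N) ℂ))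
  rw [Matrix.conjTranspose_one, Matrix.one_mul, Matrix.trace_sub, Complex.sub_re, Matrix.trace_one, Fintype.card_fin] at h
  simpa using h

/-- `0 ≤ N − Re tr X` for unitary `X`. [cite: arXiv160201222, Lemma 7.2] -/
theorem card_sub_re_trace_nonneg (hX : X ∈ Matrix.unitaryGroup (Fin N) ℂ) : 0 ≤ (N : ℝ) - X.trace.re := by
  rw [card_sub_re_trace_eq hX]; positivity

/-- `‖X − 1‖_F = √(2 (N − Re tr X))` for unitary `X`. [cite: arXiv160201222, Lemma 7.2] -/
theorem frobNorm_sub_one_eq (hX : X ∈ Matrix.unitaryGroup (Fin N) ℂ) :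
    frobNorm (X - 1) = Real.sqrt (2 * ((N : ℝ) - X.trace.re)) := by
  rw [card_sub_re_trace_eq hX, show 2 * (frobNorm (X - 1) ^ 2 / 2) = frobNorm (X - 1) ^ 2 by ring,
    Real.sqrt_sq (frobNorm_nonneg _)]

/-- **The trace shift as a Hilbert–Schmidt pairing**: for unitary `W` and any `U`,
`Re tr(Wᴴ U) − Re tr U = Re tr((W − 1)ᴴ (U − 1)) − (N − Re tr W)`. [cite: arXiv160201222, Lemma 7.2] -/
theorem re_trace_conjTranspose_mul_sub_eq (W U : Matrix (Fin N) (Fin N) ℂ) :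
    (Wᴴ * U).trace.re - U.trace.re = ((W - 1)ᴴ * (U - 1)).trace.re - ((N : ℝ) - W.trace.re) := by
  rw [Matrix.conjTranspose_sub, Matrix.conjTranspose_one, Matrix.sub_mul, Matrix.mul_sub, Matrix.mul_sub, Matrix.one_mul,
    Matrix.one_mul, Matrix.mul_one]
  simp only [Matrix.trace_sub, Complex.sub_re, Matrix.trace_one, Fintype.card_fin, Complex.natCast_re]
  rw [Matrix.trace_conjTranspose, Complex.star_def, Complex.conj_re]
  ring

/-- **`|Re tr(Wᴴ U) − Re tr U| ≤ 2√((N − Re tr W)(N − Re tr U)) + (N − Re tr W)`** for unitary `U, W` (Cauchy–Schwarz on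
the pairing form of the shift). [cite: arXiv160201222, Lemma 7.2] -/
theorem abs_traceShift_le (hW : W ∈ Matrix.unitaryGroup (Fin N) ℂ) (hU : U ∈ Matrix.unitaryGroup (Fin N) ℂ) :
    |(Wᴴ * U).trace.re - U.trace.re| ≤
      2 * Real.sqrt (((N : ℝ) - W.trace.re) * ((N : ℝ) - U.trace.re)) + ((N : ℝ) - W.trace.re) := by
  rw [re_trace_conjTranspose_mul_sub_eq]
  have hcs := abs_re_trace_conjTranspose_mul_le (W - 1) (U - 1)
  rw [frobNorm_sub_one_eq hW, frobNorm_sub_one_eq hU, ← Real.sqrt_mul (by linarith [card_sub_re_trace_nonneg hW])] at hcs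
  have hprod : Real.sqrt (2 * ((N : ℝ) - W.trace.re) * (2 * ((N : ℝ) - U.trace.re))) =
      2 * Real.sqrt (((N : ℝ) - W.trace.re) * ((N : ℝ) - U.trace.re)) := by
    rw [show 2 * ((N : ℝ) - W.trace.re) * (2 * ((N : ℝ) - U.trace.re)) =
      2 ^ 2 * (((N : ℝ) - W.trace.re) * ((N : ℝ) - U.trace.re)) by ring, Real.sqrt_mul (by positivity), Real.sqrt_sq zero_le_two]
  rw [hprod] at hcs
  have hw := card_sub_re_trace_nonneg hW
  calc |((W - 1)ᴴ * (U - 1)).trace.re - ((N : ℝ) - W.trace.re)|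
      ≤ |((W - 1)ᴴ * (U - 1)).trace.re| + |(N : ℝ) - W.trace.re| := abs_sub _ _
    _ ≤ 2 * Real.sqrt (((N : ℝ) - W.trace.re) * ((N : ℝ) - U.trace.re)) + ((N : ℝ) - W.trace.re) := by
        rw [abs_of_nonneg hw]; linarith

/-- **`(Re tr(Wᴴ U) − Re tr U)² ≤ 2(N − Re tr W)² + 8(N − Re tr W)(N − Re tr U)`** for unitary `U, W`.
[cite: arXiv160201222, Lemma 7.2] -/
theorem sq_traceShift_le (hW : W ∈ Matrix.unitaryGroup (Fin N) ℂ) (hU : U ∈ Matrix.unitaryGroup (Fin N) ℂ) :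
    ((Wᴴ * U).trace.re - U.trace.re) ^ 2 ≤
      2 * ((N : ℝ) - W.trace.re) ^ 2 + 8 * (((N : ℝ) - W.trace.re) * ((N : ℝ) - U.trace.re)) := by
  have h := abs_traceShift_le hW hU
  have hw := card_sub_re_trace_nonneg hW
  have hu := card_sub_re_trace_nonneg hU
  set a := Real.sqrt (((N : ℝ) - W.trace.re) * ((N : ℝ) - U.trace.re)) with ha_def
  have ha0 : 0 ≤ a := Real.sqrt_nonneg _
  have ha2 : a ^ 2 = ((N : ℝ) - W.trace.re) * ((N : ℝ) - U.trace.re) := Real.sq_sqrt (mul_nonneg hw hu)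
  have h2 : ((Wᴴ * U).trace.re - U.trace.re) ^ 2 ≤ (2 * a + ((N : ℝ) - W.trace.re)) ^ 2 := by
    rw [← sq_abs ((Wᴴ * U).trace.re - U.trace.re)]
    exact pow_le_pow_left₀ (abs_nonneg _) h 2
  -- `(2a + w)² ≤ 2·(2a)² + 2w² = 8a² + 2w²`
  nlinarith [sq_nonneg (2 * a - ((N : ℝ) - W.trace.re))]

/-- The shift is ODD under `U ↦ −U`: `Re tr(Wᴴ(−U)) − Re tr(−U) = −(Re tr(Wᴴ U) − Re tr U)`. [cite: arXiv160201222, Lemma 7.2] -/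
theorem traceShift_neg (W U : Matrix (Fin N) (Fin N) ℂ) :
    (Wᴴ * (-U)).trace.re - (-U).trace.re = -((Wᴴ * U).trace.re - U.trace.re) := by
  rw [Matrix.mul_neg, Matrix.trace_neg, Matrix.trace_neg, Complex.neg_re, Complex.neg_re]; ring

/-- **Reflected bound**: `(Re tr(Wᴴ U) − Re tr U)² ≤ 2(N − Re tr W)² + 8(N − Re tr W)(N + Re tr U)` for unitary `U, W`
(apply the previous bound to `−U ∈ U(N)`). [cite: arXiv160201222, Lemma 7.2] -/
theorem sq_traceShift_le_neg (hW : W ∈ Matrix.unitaryGroup (Fin N) ℂ) (hU : U ∈ Matrix.unitaryGroup (Fin N) ℂ) :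
    ((Wᴴ * U).trace.re - U.trace.re) ^ 2 ≤
      2 * ((N : ℝ) - W.trace.re) ^ 2 + 8 * (((N : ℝ) - W.trace.re) * ((N : ℝ) + U.trace.re)) := by
  have hU' : -U ∈ Matrix.unitaryGroup (Fin N) ℂ := by
    rw [Matrix.mem_unitaryGroup_iff] at hU ⊢
    simpa using hU
  have h := sq_traceShift_le hW hU'
  rw [traceShift_neg, neg_sq, Matrix.trace_neg, Complex.neg_re, sub_neg_eq_add] at h
  exact h

/-- **Two-sided small-field form**: `(Re tr(Wᴴ U) − Re tr U)² ≤ 2(N − Re tr W)² + 8(N − Re tr W)·min(N − Re tr U, N + Re tr U)`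
— near both `U = 1` and `U = −1` the shift is small (for `SU(2)`: `min(2 − Re tr U, 2 + Re tr U) = 2 − |Re tr U|`).
[cite: arXiv160201222, Lemma 7.2] -/
theorem sq_traceShift_le_min (hW : W ∈ Matrix.unitaryGroup (Fin N) ℂ) (hU : U ∈ Matrix.unitaryGroup (Fin N) ℂ) :
    ((Wᴴ * U).trace.re - U.trace.re) ^ 2 ≤
      2 * ((N : ℝ) - W.trace.re) ^ 2 + 8 * (((N : ℝ) - W.trace.re) * min ((N : ℝ) - U.trace.re) ((N : ℝ) + U.trace.re)) := by
  rcases le_total ((N : ℝ) - U.trace.re) ((N : ℝ) + U.trace.re) with h | h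
  · rw [min_eq_left h]; exact sq_traceShift_le hW hU
  · rw [min_eq_right h]; exact sq_traceShift_le_neg hW hU

/-- For `N = 2`: `min(2 − x, 2 + x) = 2 − |x|`. [folklore] -/
private theorem min_two_sub_two_add (x : ℝ) : min (2 - x) (2 + x) = 2 - abs x := by
  rcases le_total 0 x with h | h
  · rw [abs_of_nonneg h, min_eq_left (by linarith)]
  · rw [abs_of_nonpos h, min_eq_right (by linarith)]; ring

/-! ### On the group `SU(N)` (subtype form, `W⁻¹ * U`) -/

/-- For `U, W ∈ SU(N)`: `((W⁻¹U : SU(N)) : M_N) = Wᴴ U`. [folklore] -/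
private theorem coe_inv_mul (W U : Matrix.specialUnitaryGroup (Fin N) ℂ) :
    ((W⁻¹ * U : Matrix.specialUnitaryGroup (Fin N) ℂ) : Matrix (Fin N) (Fin N) ℂ) =
      (W : Matrix (Fin N) (Fin N) ℂ)ᴴ * (U : Matrix (Fin N) (Fin N) ℂ) := by
  rw [← Matrix.star_eq_inv, Submonoid.coe_mul, Matrix.specialUnitaryGroup.coe_star, Matrix.star_eq_conjTranspose]

/-- Elements of `SU(N)` are unitary matrices. [folklore] -/
private theorem mem_unitary (U : Matrix.specialUnitaryGroup (Fin N) ℂ) :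
    (U : Matrix (Fin N) (Fin N) ℂ) ∈ Matrix.unitaryGroup (Fin N) ℂ :=
  (Matrix.mem_specialUnitaryGroup_iff.mp U.2).1

/-- **`SU(N)` form**: `(Re tr(W⁻¹U) − Re tr U)² ≤ 2(N − Re tr W)² + 8(N − Re tr W)·min(N − Re tr U, N + Re tr U)` for
`U, W ∈ SU(N)`. [cite: arXiv160201222, Lemma 7.2] -/
theorem sq_re_trace_inv_mul_sub_le (W U : Matrix.specialUnitaryGroup (Fin N) ℂ) :
    ((((W⁻¹ * U : Matrix.specialUnitaryGroup (Fin N) ℂ) : Matrix (Fin N) (Fin N) ℂ).trace.re) - ((U : Matrix (Fin N) (Fin N) ℂ).trace.re)) ^ 2 ≤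
      2 * ((N : ℝ) - ((W : Matrix (Fin N) (Fin N) ℂ).trace.re)) ^ 2 +
        8 * (((N : ℝ) - ((W : Matrix (Fin N) (Fin N) ℂ).trace.re)) * min ((N : ℝ) - ((U : Matrix (Fin N) (Fin N) ℂ).trace.re)) ((N : ℝ) + ((U : Matrix (Fin N) (Fin N) ℂ).trace.re))) := by
  rw [coe_inv_mul]
  exact sq_traceShift_le_min (mem_unitary W) (mem_unitary U)

/-- **`SU(2)` form (the one-link trigonometry of the femto route)**: for `U, W ∈ SU(2)`,
`(Re tr(W⁻¹U) − Re tr U)² ≤ 2(2 − Re tr W)² + 8(2 − Re tr W)(2 − |Re tr U|)`. [cite: arXiv160201222, Lemma 7.2] -/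
theorem sq_re_trace_inv_mul_sub_le_su2 (W U : Matrix.specialUnitaryGroup (Fin 2) ℂ) :
    ((((W⁻¹ * U : Matrix.specialUnitaryGroup (Fin 2) ℂ) : Matrix (Fin 2) (Fin 2) ℂ).trace.re) - ((U : Matrix (Fin 2) (Fin 2) ℂ).trace.re)) ^ 2 ≤
      2 * (2 - ((W : Matrix (Fin 2) (Fin 2) ℂ).trace.re)) ^ 2 + 8 * ((2 - ((W : Matrix (Fin 2) (Fin 2) ℂ).trace.re)) * (2 - abs ((U : Matrix (Fin 2) (Fin 2) ℂ).trace.re))) := by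
  have h := sq_re_trace_inv_mul_sub_le W U
  rw [Nat.cast_ofNat, min_two_sub_two_add] at h
  exact h

/-- **Linear form on `SU(N)`**: `|Re tr(W⁻¹U) − Re tr U| ≤ 2√((N − Re tr W)(N − Re tr U)) + (N − Re tr W)`.
[cite: arXiv160201222, Lemma 7.2] -/
theorem abs_re_trace_inv_mul_sub_le (W U : Matrix.specialUnitaryGroup (Fin N) ℂ) :
    abs ((((W⁻¹ * U : Matrix.specialUnitaryGroup (Fin N) ℂ) : Matrix (Fin N) (Fin N) ℂ).trace.re) - ((U : Matrix (Fin N) (Fin N) ℂ).trace.re)) ≤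
      2 * Real.sqrt (((N : ℝ) - ((W : Matrix (Fin N) (Fin N) ℂ).trace.re)) * ((N : ℝ) - ((U : Matrix (Fin N) (Fin N) ℂ).trace.re))) + ((N : ℝ) - ((W : Matrix (Fin N) (Fin N) ℂ).trace.re)) := by
  rw [coe_inv_mul]
  exact abs_traceShift_le (mem_unitary W) (mem_unitary U)

end Literature.MathematicalPhysics.QuantumFieldTheory.OneLinkTraceShift
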